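import Mathlib
import Summits.ResolutionOfSingularities.ResolutionOfSingularities.Theorems.RadicialJungCleanModelsCleanProp44BirthChainStep
import HarnessLib

/-!
# Route `RadicialJung`, crux `CleanModels` (stmt-ResolutionOfSingularities-15917), line `Sketch` rev 35, stub 6 `stub_cleanProp44` (X44c):
# AFTER INSERTING AT A BIRTH: the unit test is exhausted, and the exceptional divisor becomes a SIMPLE component — the leaf `U − c₀^p`

Seat decomp-res-hand-2 g19 (structural hand); honest sequel of ✓ `…CleanProp44CrossInsertion.lean` / ✓ `…CleanProp44BirthChainStep.lean`.  Those theorems say: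
after inserting at a birth `x` (unit form `U · e^A · D^p`, `p ∣ A`, `N = (e, y)`), the strict transform `N' = (ε, ζ)` is clean-permissible at `x'` UNLESS the
pulled-back unit `σ^♯ U` fails the three-way non-birth test again.  THIS FILE RECORDS THAT THE SECOND ALTERNATIVE ALWAYS HOLDS when `x` was a birth in the
strong sense (`U − c₀^p ∈ N + 𝔪_x²` for some `c₀` — the negation of the non-birth test supplies such a `c₀`): so one step down a chain of births the unit test
carries no information, and the right currency is the LEAF `U − c₀^p` (memo `Sketch-memo-4e-cleanPermissible.md` §2.5 «the new leaf class at `c'` is that of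
`t' := U − γ^p`»):

* `map_span_pair_sup_sq_le_span_mul` — `σ^♯ (N + 𝔪_x²) 𝒪_{X',x'} ⊆ E · 𝔪_{x'}`.
* `sub_pow_mem_sq_of_birth` — for EVERY `c'`: `σ^♯ U − c'^p ∈ 𝔪_{x'}` implies `σ^♯ U − c'^p ∈ 𝔪_{x'}²` (Frobenius: `a^p − b^p = (a − b)^p`); hence
  `not_nonbirth_of_birth` — `σ^♯ U` fails the non-birth test at `x'` for EVERY curve ideal `N' ⊆ 𝔪_{x'}`.
* `exists_leaf_rep_of_birth` — THE POSITIVE CONTENT: `σ^♯ U − (σ^♯ c₀)^p = E · g` with `g ∈ 𝔪_{x'}`, and the line of `σ^♯ G` has at `x'` the non-trivial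
  representative `E · g`: the exceptional divisor `E_x` is a SIMPLE component (exponent `1`, prime to `p`) of a representative and `x'` lies on the strict
  transform `V(g)` of the leaf `V(U − c₀^p)`.  Precise reading: clean-permissibility at `x'` must now be decided from this representative `E · g` (or another
  one), NOT from the unit form `σ^♯ U · ε^A · E^A · D^p`, whose non-birth test is void there; `E · g` is a clean monomial exactly when the divisor of `g` is in
  normal crossings with `E` in a regular system adapted to the curve (then ✓ `cleanPermissibleAt_or_obstruction_of_sideFamily_general` applies to it) — the
  behaviour of `g` along the chain is the `δ*/ν`-descent of memo 4e §2.5–2.6, not addressed here.  (Representatives of the line are the non-trivial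
  `K^p`-combinations of `1, G, …, G^{p-1}`; two of them are not multiplicatively related in general, so «`E` is a charged component» is a statement about THIS
  representative.)

Honest framing: OURS; corrects the reading of the birth alternative in `…CrossInsertion` / `…BirthChainStep` (true, but automatically satisfied one step down a
birth chain).  The shape of `g` (the `δ*/ν`-descent, memo 4e §2.5–2.6) is NOT addressed.  Nothing here proves X44c, any case of `CleanModels`, or resolution of
singularities in characteristic `p`.  Setting only: [cite: CossartPiltant2008, Lemma 4.3 (5); Prop. 4.4 (proof, p. 11)] [cite: Piltant2013, §2 Axiom 4].
-/

noncomputable section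

set_option linter.dupNamespace false -- mandated namespace of this single-conjunct summit

open IsLocalRing CategoryTheory AlgebraicGeometry
open Literature.AlgebraicGeometry.Resolution Literature.AlgebraicGeometry.Motives

namespace Summit.ResolutionOfSingularities.ResolutionOfSingularities.Theorems.RadicialJung.CleanModels

universe u

section Scheme

variable {p : ℕ} {X X' : Scheme.{u}} [IsIntegral X] [IsIntegral X'] {σ : X' ⟶ X} [IsDominant σ] {J : X.IdealSheafData}

omit [IsIntegral X] [IsIntegral X'] [IsDominant σ] in
/-- **`σ^♯ (N + 𝔪_x²) ⊆ E · 𝔪_{x'}`**: for `N = (e, y)` with `σ^♯ e = E ε`, `σ^♯ y = E ζ` (`ε, ζ ∈ 𝔪_{x'}`) and `(E) = 𝔪_x 𝒪_{X',x'}`.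
[cite: GortzWedhorn2020, Prop. 13.91] -/
theorem map_span_pair_sup_sq_le_span_mul (x' : X') {e y : X.presheaf.stalk (σ x')} {E ε ζ : X'.presheaf.stalk x'}
    (hE : Ideal.span {E} = (maximalIdeal (X.presheaf.stalk (σ x'))).map (σ.stalkMap x').hom)
    (hε : (σ.stalkMap x').hom e = E * ε) (hεm : ε ∈ maximalIdeal (X'.presheaf.stalk x'))
    (hζ : (σ.stalkMap x').hom y = E * ζ) (hζm : ζ ∈ maximalIdeal (X'.presheaf.stalk x')) :
    (Ideal.span ({e, y} : Set (X.presheaf.stalk (σ x'))) ⊔ maximalIdeal (X.presheaf.stalk (σ x')) ^ 2).map (σ.stalkMap x').hom ≤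
      Ideal.span {E} * maximalIdeal (X'.presheaf.stalk x') := by
  have hEm : E ∈ maximalIdeal (X'.presheaf.stalk x') := by
    have h1 : E ∈ (maximalIdeal (X.presheaf.stalk (σ x'))).map (σ.stalkMap x').hom := hE ▸ Ideal.mem_span_singleton_self E
    exact (Ideal.map_le_iff_le_comap.mpr fun r hr => Ideal.mem_comap.mpr (map_nonunit (σ.stalkMap x').hom r hr)) h1
  rw [Ideal.map_sup, sup_le_iff]
  constructor
  · rw [Ideal.map_span, Ideal.span_le]
    rintro _ ⟨r, hr, rfl⟩
    rw [SetLike.mem_coe]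
    rcases hr with rfl | hr
    · rw [hε]; exact Ideal.mul_mem_mul (Ideal.mem_span_singleton_self _) hεm
    · rw [Set.mem_singleton_iff.mp hr, hζ]; exact Ideal.mul_mem_mul (Ideal.mem_span_singleton_self _) hζm
  · rw [Ideal.map_pow, ← hE, pow_two]
    exact Ideal.mul_mono_right ((Ideal.span_singleton_le_iff_mem _).mpr hEm)

omit [IsIntegral X] [IsDominant σ] in
/-- **After a birth the unit test is exhausted**: if `U − c₀^p ∈ N + 𝔪_x²` at `x`, then at every `x'` as above, for EVERY `c'`, `σ^♯ U − c'^p ∈ 𝔪_{x'}` forces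
`σ^♯ U − c'^p ∈ 𝔪_{x'}²` (`σ^♯ U − (σ^♯ c₀)^p ∈ E 𝔪_{x'} ⊆ 𝔪_{x'}²` and `(σ^♯ c₀)^p − c'^p = (σ^♯ c₀ − c')^p`). [cite: CossartPiltant2008, Prop. 4.4 (proof, p. 11)] -/
theorem sub_pow_mem_sq_of_birth [hp : Fact p.Prime] [CharP X'.functionField p] (x' : X') {e y : X.presheaf.stalk (σ x')}
    {E ε ζ : X'.presheaf.stalk x'} (hE : Ideal.span {E} = (maximalIdeal (X.presheaf.stalk (σ x'))).map (σ.stalkMap x').hom)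
    (hε : (σ.stalkMap x').hom e = E * ε) (hεm : ε ∈ maximalIdeal (X'.presheaf.stalk x'))
    (hζ : (σ.stalkMap x').hom y = E * ζ) (hζm : ζ ∈ maximalIdeal (X'.presheaf.stalk x'))
    {U c₀ : X.presheaf.stalk (σ x')}
    (hc₀ : U - c₀ ^ p ∈ Ideal.span ({e, y} : Set (X.presheaf.stalk (σ x'))) ⊔ maximalIdeal (X.presheaf.stalk (σ x')) ^ 2)
    (c' : X'.presheaf.stalk x') (hc' : (σ.stalkMap x').hom U - c' ^ p ∈ maximalIdeal (X'.presheaf.stalk x')) :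
    (σ.stalkMap x').hom U - c' ^ p ∈ maximalIdeal (X'.presheaf.stalk x') ^ 2 := by
  haveI : CharP (X'.presheaf.stalk x') p := (RatFn.toFunctionField x').charP (RatFn.toFunctionField_injective x') p
  have hEm : E ∈ maximalIdeal (X'.presheaf.stalk x') := by
    have h1 : E ∈ (maximalIdeal (X.presheaf.stalk (σ x'))).map (σ.stalkMap x').hom := hE ▸ Ideal.mem_span_singleton_self E
    exact (Ideal.map_le_iff_le_comap.mpr fun r hr => Ideal.mem_comap.mpr (map_nonunit (σ.stalkMap x').hom r hr)) h1
  -- `σ^♯ U − (σ^♯ c₀)^p ∈ E 𝔪' ⊆ 𝔪'²`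
  have h0 : (σ.stalkMap x').hom U - (σ.stalkMap x').hom c₀ ^ p ∈ maximalIdeal (X'.presheaf.stalk x') ^ 2 := by
    have h1 : (σ.stalkMap x').hom (U - c₀ ^ p) ∈ Ideal.span {E} * maximalIdeal (X'.presheaf.stalk x') :=
      map_span_pair_sup_sq_le_span_mul x' hE hε hεm hζ hζm (Ideal.mem_map_of_mem _ hc₀)
    rw [map_sub, map_pow] at h1
    rw [pow_two]
    exact Ideal.mul_mono_left ((Ideal.span_singleton_le_iff_mem _).mpr hEm) h1
  have hsplit : (σ.stalkMap x').hom U - c' ^ p =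
      ((σ.stalkMap x').hom U - (σ.stalkMap x').hom c₀ ^ p) + ((σ.stalkMap x').hom c₀ - c') ^ p := by
    rw [sub_pow_char ((σ.stalkMap x').hom c₀) c']; ring
  by_cases hcc : (σ.stalkMap x').hom c₀ - c' ∈ maximalIdeal (X'.presheaf.stalk x')
  · rw [hsplit]
    refine Ideal.add_mem _ h0 ?_
    exact Ideal.pow_le_pow_right hp.out.two_le (Ideal.pow_mem_pow hcc p)
  · exfalso
    have hu : IsUnit (((σ.stalkMap x').hom c₀ - c') ^ p) := (IsLocalRing.notMem_maximalIdeal.mp hcc).pow p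
    have hmem : ((σ.stalkMap x').hom c₀ - c') ^ p ∈ maximalIdeal (X'.presheaf.stalk x') := by
      have h2 : ((σ.stalkMap x').hom c₀ - c') ^ p = ((σ.stalkMap x').hom U - c' ^ p) - ((σ.stalkMap x').hom U - (σ.stalkMap x').hom c₀ ^ p) := by
        rw [hsplit]; ring
      rw [h2]
      exact Ideal.sub_mem _ hc' (Ideal.pow_le_self two_ne_zero h0)
    exact (IsLocalRing.notMem_maximalIdeal.mpr hu) hmem

omit [IsIntegral X] [IsDominant σ] in
/-- **Hence the three-way non-birth test fails for `σ^♯ U` at `x'`, for EVERY curve ideal `N' ⊆ 𝔪_{x'}`** — the birth alternative of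
✓ `cleanPermissibleAt_strictTransform_of_unitForm_or_birth` is automatic one step down a chain of births. [cite: CossartPiltant2008, Prop. 4.4 (proof, p. 11)] -/
theorem not_nonbirth_of_birth [hp : Fact p.Prime] [CharP X'.functionField p] (x' : X') {e y : X.presheaf.stalk (σ x')}
    {E ε ζ : X'.presheaf.stalk x'} (hE : Ideal.span {E} = (maximalIdeal (X.presheaf.stalk (σ x'))).map (σ.stalkMap x').hom)
    (hε : (σ.stalkMap x').hom e = E * ε) (hεm : ε ∈ maximalIdeal (X'.presheaf.stalk x'))
    (hζ : (σ.stalkMap x').hom y = E * ζ) (hζm : ζ ∈ maximalIdeal (X'.presheaf.stalk x'))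
    {U c₀ : X.presheaf.stalk (σ x')}
    (hc₀ : U - c₀ ^ p ∈ Ideal.span ({e, y} : Set (X.presheaf.stalk (σ x'))) ⊔ maximalIdeal (X.presheaf.stalk (σ x')) ^ 2)
    {N' : Ideal (X'.presheaf.stalk x')} (hN' : N' ≤ maximalIdeal (X'.presheaf.stalk x')) :
    ¬ ((∀ c' : X'.presheaf.stalk x', (σ.stalkMap x').hom U - c' ^ p ∉ maximalIdeal (X'.presheaf.stalk x')) ∨
      (∃ c' : X'.presheaf.stalk x', (σ.stalkMap x').hom U - c' ^ p ∈ maximalIdeal (X'.presheaf.stalk x') ∧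
        (σ.stalkMap x').hom U - c' ^ p ∉ N' ⊔ maximalIdeal (X'.presheaf.stalk x') ^ 2) ∨
      (∃ c' : X'.presheaf.stalk x', (σ.stalkMap x').hom U - c' ^ p ∈ N' ∧ (σ.stalkMap x').hom U - c' ^ p ∉ maximalIdeal (X'.presheaf.stalk x') ^ 2)) := by
  have key := sub_pow_mem_sq_of_birth (p := p) x' hE hε hεm hζ hζm hc₀
  -- `c' := σ^♯ c₀` lands in `𝔪'`
  have hc₀' : (σ.stalkMap x').hom U - (σ.stalkMap x').hom c₀ ^ p ∈ maximalIdeal (X'.presheaf.stalk x') := by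
    have hNle : Ideal.span ({e, y} : Set (X.presheaf.stalk (σ x'))) ⊔ maximalIdeal (X.presheaf.stalk (σ x')) ^ 2 ≤
        maximalIdeal (X.presheaf.stalk (σ x')) := by
      refine sup_le ?_ (Ideal.pow_le_self two_ne_zero)
      rw [Ideal.span_le, Set.insert_subset_iff, Set.singleton_subset_iff]
      constructor
      · by_contra h
        have hu : IsUnit ((σ.stalkMap x').hom e) := (IsLocalRing.notMem_maximalIdeal.mp h).map _
        rw [hε] at hu
        exact (IsLocalRing.notMem_maximalIdeal.mpr (isUnit_of_mul_isUnit_right hu)) hεm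
      · by_contra h
        have hu : IsUnit ((σ.stalkMap x').hom y) := (IsLocalRing.notMem_maximalIdeal.mp h).map _
        rw [hζ] at hu
        exact (IsLocalRing.notMem_maximalIdeal.mpr (isUnit_of_mul_isUnit_right hu)) hζm
    have h1 := map_nonunit (σ.stalkMap x').hom _ (hNle hc₀)
    rwa [map_sub, map_pow] at h1
  rintro (h | ⟨c', hc'm, hc'N⟩ | ⟨c', hc'N, hc'2⟩)
  · exact h _ hc₀'
  · exact hc'N (Ideal.mem_sup_right (key c' hc'm))
  · exact hc'2 (key c' (hN' hc'N))

set_option maxHeartbeats 1600000 in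
-- the leaf representative
/-- **THE LEAF REPRESENTATIVE AFTER A BIRTH.**  In the setting of ✓ `cleanPermissibleAt_strictTransform_of_unitForm_mul_pow_or_birth` (`p ∣ A`) with a birth
witness `U − c₀^p ∈ N + 𝔪_x²`: `σ^♯ U − (σ^♯ c₀)^p = E · g` with `g ∈ 𝔪_{x'}`, and the line of `σ^♯ G` has at `x'` a non-trivial representative equal to
`E · g` — the exceptional divisor is a SIMPLE component of it. [cite: CossartPiltant2008, Lemma 4.3 (5); Prop. 4.4 (proof, p. 11)] [cite: Piltant2013, §2 Axiom 4] -/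
theorem exists_leaf_rep_of_birth [Fact p.Prime] [CharP X.functionField p] [CharP X'.functionField p]
    (hσ : IsBlowup σ J) (x' : X') (hR : IsRegularLocalRing (X.presheaf.stalk (σ x'))) (hdim : ringKrullDim (X.presheaf.stalk (σ x')) = (3 : ℕ))
    (hJ : stalkIdeal J (σ x') = maximalIdeal (X.presheaf.stalk (σ x'))) {e y z : X.presheaf.stalk (σ x')}
    (hzz : Ideal.span ({e, y, z} : Set (X.presheaf.stalk (σ x'))) = maximalIdeal (X.presheaf.stalk (σ x')))
    {G : X.functionField} {cc : Fin p → X.functionField} (hcc : ∃ j : Fin p, (j : ℕ) ≠ 0 ∧ cc j ≠ 0)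
    {U : X.presheaf.stalk (σ x')} (hU : IsUnit U) {A : ℕ} (hA : p ∣ A) {D : X.presheaf.stalk (σ x')} (hD : D ≠ 0)
    (hrep : (∑ j : Fin p, cc j ^ p * G ^ (j : ℕ)) = RatFn.toFunctionField (σ x') (U * e ^ A * D ^ p))
    {c₀ : X.presheaf.stalk (σ x')}
    (hc₀ : U - c₀ ^ p ∈ Ideal.span ({e, y} : Set (X.presheaf.stalk (σ x'))) ⊔ maximalIdeal (X.presheaf.stalk (σ x')) ^ 2)
    (hdim' : ringKrullDim (X'.presheaf.stalk x') = 3) {E ε ζ : X'.presheaf.stalk x'}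
    (hE : Ideal.span {E} = (maximalIdeal (X.presheaf.stalk (σ x'))).map (σ.stalkMap x').hom)
    (hε : (σ.stalkMap x').hom e = E * ε) (hεm : ε ∈ maximalIdeal (X'.presheaf.stalk x'))
    (hζ : (σ.stalkMap x').hom y = E * ζ) (hζm : ζ ∈ maximalIdeal (X'.presheaf.stalk x')) :
    Ideal.span ({ε, ζ, E} : Set (X'.presheaf.stalk x')) = maximalIdeal (X'.presheaf.stalk x') ∧
    ∃ g : X'.presheaf.stalk x', g ∈ maximalIdeal (X'.presheaf.stalk x') ∧ (σ.stalkMap x').hom U - (σ.stalkMap x').hom c₀ ^ p = E * g ∧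
      ∃ cc' : Fin p → X'.functionField, (∃ j : Fin p, (j : ℕ) ≠ 0 ∧ cc' j ≠ 0) ∧
        (∑ j : Fin p, cc' j ^ p * RatFn.functionFieldMap σ G ^ (j : ℕ)) = RatFn.toFunctionField x' (E * g) := by
  classical
  obtain ⟨hzz', -, hD', hrep'⟩ := cleanPermissibleAt_strictTransform_of_unitForm_mul_pow_or_birth_next hσ x' hR hdim hJ hzz hcc hU hA hD hrep
    hdim' hE hε hεm hζ hζm
  -- the leaf: `σ^♯ (U − c₀^p) ∈ E 𝔪'`
  have h1 : (σ.stalkMap x').hom (U - c₀ ^ p) ∈ Ideal.span {E} * maximalIdeal (X'.presheaf.stalk x') :=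
    map_span_pair_sup_sq_le_span_mul x' hE hε hεm hζ hζm (Ideal.mem_map_of_mem _ hc₀)
  obtain ⟨g, hgm, hg⟩ := Ideal.mem_span_singleton_mul.mp h1
  rw [map_sub, map_pow] at hg
  refine ⟨hzz', g, hgm, hg.symm, ?_⟩
  -- the representative: subtract `(σ^♯ c₀ · D')^p`
  obtain ⟨hcc', -⟩ := rep_functionFieldMap x' hcc hrep
  have hd : RatFn.toFunctionField x' (ε ^ (A / p) * E ^ (A / p) * (σ.stalkMap x').hom D) ≠ 0 :=
    (map_ne_zero_iff _ (RatFn.toFunctionField_injective x')).mpr hD'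
  have hX : (∑ j : Fin p, RatFn.functionFieldMap σ (cc j) ^ p * RatFn.functionFieldMap σ G ^ (j : ℕ)) =
      RatFn.toFunctionField x' ((σ.stalkMap x').hom U) * RatFn.toFunctionField x' (ε ^ (A / p) * E ^ (A / p) * (σ.stalkMap x').hom D) ^ p := by
    rw [hrep', pow_zero, mul_one, map_mul, map_pow]
  obtain ⟨cc', hcc'', hsum⟩ := exists_rep_of_rep_eq_mul_pow_sub p (RatFn.functionFieldMap σ G) _ hcc' hd hX
    (RatFn.toFunctionField x' ((σ.stalkMap x').hom c₀))
  refine ⟨cc', hcc'', ?_⟩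
  rw [hsum, ← map_pow, ← map_sub, hg]

end Scheme

end Summit.ResolutionOfSingularities.ResolutionOfSingularities.Theorems.RadicialJung.CleanModels

end
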